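import Summits.ABC.StewartYu.PadicG3TwoSchedSatN
import Summits.ABC.StewartYu.PadicG3TwoFirstExp
import HarnessLib

/-!
# Cell abc-stewartyu, WP-L.P(2) (crux r4 `PadicCoreTwoRat`, stmt-ABC-20504), line `padic-two-sat-frame`, stub `stub_smallTwoN`:
# ONE smallness exponent for every `‖Λ₀‖`-branch of the 𝔑-threaded schedule of record `schedTwoN`

`Summits/ABC/StewartYu/PadicG3TwoFirstExpSat.lean` — cell `abc-stewartyu` (HOME `run/shared/lean/pub/abc-stewartyu/`), route
`YuMatveevShapeRat`, seat lp-1 g8 (taker of `stub_smallTwoN`, STATUS 2026-08-27 19:5xZ).  Theorems only (natural-number arithmetic);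
the Sat twin of p3's `PadicG3TwoFirstExp` (schedule `schedTwoS`) for p3's `schedTwoN S F P` (`PadicG3TwoSchedSatN`: floored decrement
`T3N I = max 8 (4L/3^I)`, capped ranges `Xs3N I = 4XL/(T3N I + 1)`, start orders with the linear reserve `16(n+2)(I*N + 1 − I)`).

The `‖Λ₀‖`-branch of a k-step / third step is below its gain branch as soon as `‖Λ₀‖ ≤ 2^{−e}`, `e = t + condExp 2 (2N+1) t + (m+2)·g`
(`PadicG3TwoFirstBranch.first_le_gain`, schedule-generic), and `e ≤ (m+6)·B` whenever `g ≤ (2N+1)·t ≤ B` (`first_exp_le`).  Along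
`schedTwoN` the node–multiplicity products are uniformly bounded: `(2·Nsub3N I k + 1)·T3N I ≤ 3^{d+5}·X·L` (`Xs3N I·(T3N I+1) ≤ 4XL`,
`T3N I ≤ 4L`, `k ≤ d+2`) and `(2·Nfin I + 1)·t₃ ≤ (d+3)·3^{d+6}·X·L` (the reserve makes `t₃ ≤ (d+3)·(T3N I + 16) ≤ 3(d+3)·T3N I`).  Hence
the single exponent **`(m+6)·(d+3)·3^{d+6}·X·L`** dominates every first-branch exponent of (L2₀)/(L2)/(L3) of `schedTwoN`:
`kExpA_schedTwoN_le`, `kExp_schedTwoN_le`, `tExp_schedTwoN_le`.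

WHAT THIS IS NOT: the comparison with the crux threshold (headline, sequel), the gain branches (p3), sizes; no crux moves (A1.L not moved).

References: K. Yu, Acta Math. 211 (2013), Lemma 5.1, (5.19), (5.58); K. Yu, Compositio Math. 74 (1990), §3; Yu. V. Nesterenko, LNM 1819
(2003), §4 (4.3)–(4.5).
-/

noncomputable section

open Finset
open Literature.NumberTheory.Transcendental
open Literature.NumberTheory.Transcendental.CW77.Setup (Tau tauNorm)
open Literature.NumberTheory.Transcendental.PadicCW77 (condExp)

namespace Summit.ABC.StewartYu

namespace TwoSetup

open Summit.ABC.StewartYu.G3Boxes Summit.ABC.StewartYu.PadicG3Par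

variable (S : TwoSetup) (F : S.SatData) (P : PadicG3Par (S.d + 1))

/-! ### The schedule arithmetic of `schedTwoN` -/

/-- `8 ≤ 4·L` (`L ≥ 2^25`). [folklore] -/
theorem eight_le_four_mul_L : 8 ≤ 4 * P.L := by
  have h : (2 : ℝ) ^ 25 ≤ P.L := P.two_pow_25_le_L
  have h2 : (2 : ℝ) ≤ P.L := le_trans (by norm_num) h
  have : 2 ≤ P.L := by exact_mod_cast h2
  omega

/-- `T3N I ≤ 4·L` (the floor `8` is below `4L`). [folklore] -/
theorem T3N_le (I : ℕ) : S.T3N P I ≤ 4 * P.L := by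
  unfold T3N
  exact max_le (S.eight_le_four_mul_L P) (Nat.div_le_self _ _)

/-- `Xs3N I · (T3N I + 1) ≤ 4·X·L` (natural numbers). [folklore] -/
theorem Xs3N_mul_le_nat (I : ℕ) : S.Xs3N P I * (S.T3N P I + 1) ≤ 4 * P.X * P.L := by
  unfold Xs3N; exact Nat.div_mul_le_self _ _

/-- At level `0` the floored decrement is the plain one: `T3N 0 = 4L`, so `Xs3N 0 = Xs3 0`. [folklore] -/
theorem Xs3N_zero_eq : S.Xs3N P 0 = S.Xs3 P 0 := by
  have hT : S.T3N P 0 = S.T3 P 0 := by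
    unfold T3N T3
    rw [pow_zero, Nat.div_one]
    exact max_eq_right (S.eight_le_four_mul_L P)
  unfold Xs3N Xs3
  rw [hT]

/-- `Nsub3N I k ≤ 3^{k+1}·Xs3N I` (at `(0,0)`: `X ≤ 3·Xs3N 0 = 3·Xs3 0`). [folklore] -/
theorem Nsub3N_le (I k : ℕ) : S.Nsub3N P I k ≤ 3 ^ (k + 1) * S.Xs3N P I := by
  unfold Nsub3N
  split_ifs with hk hI
  · subst hk; subst hI
    rw [S.Xs3N_zero_eq P]
    have h := S.Xs3_zero_ge P
    have hX : (0:ℝ) ≤ P.X := by positivity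
    have : (P.X : ℝ) ≤ 3 * (S.Xs3 P 0 : ℝ) := by linarith
    rw [pow_one]; exact_mod_cast this
  · subst hk; rw [zero_add, pow_one]
  · rw [pow_succ]
    calc 3 ^ k * S.Xs3N P I = 3 ^ k * 1 * S.Xs3N P I := by ring
      _ ≤ 3 ^ k * 3 * S.Xs3N P I := by gcongr; norm_num

/-- **The node–multiplicity product of every k-step of `schedTwoN`**: `(2·Nsub3N I k + 1)·T3N I ≤ 3^{d+5}·X·L` (`k ≤ d + 2`).
[cite: Nesterenko2003, §4 (4.3); shape only] -/
theorem nodes_mul_T3N_le (I : ℕ) {k : ℕ} (hk : k ≤ S.d + 2) :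
    (2 * S.Nsub3N P I k + 1) * S.T3N P I ≤ 3 ^ (S.d + 5) * (P.X * P.L) := by
  have hN := S.Nsub3N_le P I k
  have hXT := S.Xs3N_mul_le_nat P I
  have hX : 1 ≤ P.X := le_trans (by norm_num) P.seventytwo_le_X'
  have h3 : 3 ^ (k + 1) ≤ 3 ^ (S.d + 3) := Nat.pow_le_pow_right (by norm_num) (by omega)
  have hXs : S.Xs3N P I * S.T3N P I ≤ 4 * P.X * P.L := le_trans (Nat.mul_le_mul_left _ (Nat.le_succ _)) hXT
  have hT : S.T3N P I ≤ 4 * P.L := S.T3N_le P I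
  have e : 3 ^ (S.d + 5) = 9 * 3 ^ (S.d + 3) := by rw [pow_add 3 (S.d + 3) 2]; ring
  calc (2 * S.Nsub3N P I k + 1) * S.T3N P I
      ≤ (2 * (3 ^ (S.d + 3) * S.Xs3N P I) + 1) * S.T3N P I := by
        apply Nat.mul_le_mul_right; have := Nat.mul_le_mul_right (S.Xs3N P I) h3; omega
    _ = 2 * 3 ^ (S.d + 3) * (S.Xs3N P I * S.T3N P I) + S.T3N P I := by ring
    _ ≤ 2 * 3 ^ (S.d + 3) * (4 * P.X * P.L) + 4 * P.L := by gcongr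
    _ ≤ 3 ^ (S.d + 5) * (P.X * P.L) := by
        rw [e]
        have : 4 * P.L ≤ 3 ^ (S.d + 3) * (P.X * P.L) := by
          have h27 : 27 ≤ 3 ^ (S.d + 3) := by
            calc 27 = 3 ^ 3 := by norm_num
              _ ≤ 3 ^ (S.d + 3) := Nat.pow_le_pow_right (by norm_num) (by omega)
          have hXL : P.L ≤ P.X * P.L := Nat.le_mul_of_pos_left _ (by omega)
          calc 4 * P.L ≤ 27 * (P.X * P.L) := by omega
            _ ≤ 3 ^ (S.d + 3) * (P.X * P.L) := Nat.mul_le_mul_right _ h27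
        nlinarith

/-- **The third-step multiplicity of `schedTwoN` from above**: `Tfin I − T0 (I+1) ≤ 3·(d+3)·T3N I` (the reserve adds at most
`16(d+3) ≤ 2(d+3)·T3N I`). [folklore] -/
theorem t3N_le (I : ℕ) : (S.schedTwoN F P).Tfin I - (S.schedTwoN F P).T0 (I + 1) ≤ 3 * ((S.d + 3) * S.T3N P I) := by
  rw [schedTwoN_Tfin, schedTwoN_T0]
  unfold T03N
  have hT := S.T3N_ge P I
  have ea : S.d + 1 + 2 = S.d + 3 := by ring
  rw [ea]
  generalize P.M / (S.d + 3) ^ 3 = M₃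
  generalize S.Istar3N F P = Is
  generalize S.T3N P I = T at hT ⊢
  generalize S.T3N P (I + 1) = T'
  generalize S.d + 3 = a
  have h1 : 16 * a * (Is + 1 - I) ≤ 16 * a * (Is + 1 - (I + 1)) + 16 * a := by
    have : Is + 1 - I ≤ (Is + 1 - (I + 1)) + 1 := by omega
    calc 16 * a * (Is + 1 - I) ≤ 16 * a * ((Is + 1 - (I + 1)) + 1) := Nat.mul_le_mul_left _ this
      _ = 16 * a * (Is + 1 - (I + 1)) + 16 * a := by ring
  have h2 : 16 * a ≤ 2 * (a * T) := by nlinarith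
  have e1 : 2 * a * T = 2 * (a * T) := by ring
  have e2 : 2 * a * T' = 2 * (a * T') := by ring
  rw [e1, e2]
  generalize 16 * a * (Is + 1 - I) = A at h1 ⊢
  generalize 16 * a * (Is + 1 - (I + 1)) = B at h1 ⊢
  generalize 16 * a = c at h1 h2 ⊢
  generalize a * T = aT at h2 ⊢
  generalize a * T' = aT'
  omega

/-- **The node–multiplicity product of the third step of `schedTwoN`**: `(2·Nfin I + 1)·t₃ ≤ (d+3)·3^{d+6}·X·L`.
[cite: Yu2013, (5.58); shape only] -/
theorem nfin_mul_t3N_le (I : ℕ) :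
    (2 * (S.schedTwoN F P).Nfin I + 1) * ((S.schedTwoN F P).Tfin I - (S.schedTwoN F P).T0 (I + 1)) ≤
      (S.d + 3) * (3 ^ (S.d + 6) * (P.X * P.L)) := by
  have ht := S.t3N_le F P I
  rw [schedTwoN_Nfin]
  have hXT := S.Xs3N_mul_le_nat P I
  have hX : 1 ≤ P.X := le_trans (by norm_num) P.seventytwo_le_X'
  have hXs : S.Xs3N P I * S.T3N P I ≤ 4 * P.X * P.L := le_trans (Nat.mul_le_mul_left _ (Nat.le_succ _)) hXT
  have hT : S.T3N P I ≤ 4 * P.L := S.T3N_le P I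
  have e : 3 ^ (S.d + 6) = 3 * (9 * 3 ^ (S.d + 3)) := by rw [pow_add 3 (S.d + 3) 3]; ring
  calc (2 * (3 ^ (S.d + 3) * S.Xs3N P I) + 1) * ((S.schedTwoN F P).Tfin I - (S.schedTwoN F P).T0 (I + 1))
      ≤ (2 * (3 ^ (S.d + 3) * S.Xs3N P I) + 1) * (3 * ((S.d + 3) * S.T3N P I)) := Nat.mul_le_mul_left _ ht
    _ = (S.d + 3) * (3 * (2 * 3 ^ (S.d + 3) * (S.Xs3N P I * S.T3N P I) + S.T3N P I)) := by ring
    _ ≤ (S.d + 3) * (3 * (2 * 3 ^ (S.d + 3) * (4 * P.X * P.L) + 4 * P.L)) := by gcongr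
    _ ≤ (S.d + 3) * (3 ^ (S.d + 6) * (P.X * P.L)) := by
        apply Nat.mul_le_mul_left
        rw [e]
        have : 4 * P.L ≤ 3 ^ (S.d + 3) * (P.X * P.L) := by
          have h27 : 27 ≤ 3 ^ (S.d + 3) := by
            calc 27 = 3 ^ 3 := by norm_num
              _ ≤ 3 ^ (S.d + 3) := Nat.pow_le_pow_right (by norm_num) (by omega)
          have hXL : P.L ≤ P.X * P.L := Nat.le_mul_of_pos_left _ (by omega)
          calc 4 * P.L ≤ 27 * (P.X * P.L) := by omega
            _ ≤ 3 ^ (S.d + 3) * (P.X * P.L) := Nat.mul_le_mul_right _ h27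
        nlinarith

/-! ### The smallness exponents of `schedTwoN` -/

/-- **Level `0` (all nodes)**: the first-branch exponent of every sub-step of `schedTwoN` is `≤ (m+6)·(d+3)·3^{d+6}·X·L`.
[cite: Yu2013, Lemma 5.1; shape only] -/
theorem kExpA_schedTwoN_le {k : ℕ} (hk : k < S.d + 3) :
    (S.schedTwoN F P).tdec 0 + condExp 2 (2 * (S.schedTwoN F P).Nsub 0 k + 1) ((S.schedTwoN F P).tdec 0) +
        ((S.schedTwoN F P).m + 2) * gainExpA (S.schedTwoN F P) 0 k ≤
      (P.m + 6) * ((S.d + 3) * (3 ^ (S.d + 6) * (P.X * P.L))) := by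
  rw [schedTwoN_tdec, schedTwoN_Nsub, schedTwoN_m]
  have hg : gainExpA (S.schedTwoN F P) 0 k ≤ (2 * S.Nsub3N P 0 k + 1) * S.T3N P 0 := by
    unfold gainExpA; rw [schedTwoN_Nsub, schedTwoN_tdec]
  have hB := S.nodes_mul_T3N_le P 0 (k := k) (by omega)
  have h56 : 3 ^ (S.d + 5) * (P.X * P.L) ≤ 3 ^ (S.d + 6) * (P.X * P.L) :=
    Nat.mul_le_mul_right _ (Nat.pow_le_pow_right (by norm_num) (by omega))
  have hB' : (2 * S.Nsub3N P 0 k + 1) * S.T3N P 0 ≤ (S.d + 3) * (3 ^ (S.d + 6) * (P.X * P.L)) :=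
    (hB.trans h56).trans (Nat.le_mul_of_pos_left _ (by omega))
  exact first_exp_le hg hB'

/-- **Levels `I ≥ 1`**: `kExp (schedTwoN) I k ≤ (m+6)·(d+3)·3^{d+6}·X·L`. [cite: Yu2013, Lemma 5.1; shape only] -/
theorem kExp_schedTwoN_le (I : ℕ) {k : ℕ} (hk : k < S.d + 3) :
    kExp (S.schedTwoN F P) I k ≤ (P.m + 6) * ((S.d + 3) * (3 ^ (S.d + 6) * (P.X * P.L))) := by
  unfold kExp
  rw [schedTwoN_tdec, schedTwoN_Nsub, schedTwoN_m]
  have hg : gainExp (S.schedTwoN F P) I k ≤ (2 * S.Nsub3N P I k + 1) * S.T3N P I := by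
    have := gainExp_le (S.schedTwoN F P) I k
    rw [schedTwoN_Nsub, schedTwoN_tdec] at this; exact this
  have hB := S.nodes_mul_T3N_le P I (k := k) (by omega)
  have h56 : 3 ^ (S.d + 5) * (P.X * P.L) ≤ 3 ^ (S.d + 6) * (P.X * P.L) :=
    Nat.mul_le_mul_right _ (Nat.pow_le_pow_right (by norm_num) (by omega))
  have hB' : (2 * S.Nsub3N P I k + 1) * S.T3N P I ≤ (S.d + 3) * (3 ^ (S.d + 6) * (P.X * P.L)) :=
    (hB.trans h56).trans (Nat.le_mul_of_pos_left _ (by omega))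
  exact first_exp_le hg hB'

/-- **Third steps**: `tExp (schedTwoN) I ≤ (m+6)·(d+3)·3^{d+6}·X·L`. [cite: Yu2013, Lemma 5.1 and (5.58); shape only] -/
theorem tExp_schedTwoN_le (I : ℕ) :
    tExp (S.schedTwoN F P) I ≤ (P.m + 6) * ((S.d + 3) * (3 ^ (S.d + 6) * (P.X * P.L))) := by
  unfold tExp
  rw [schedTwoN_m]
  exact first_exp_le le_rfl (S.nfin_mul_t3N_le F P I)

end TwoSetup

end Summit.ABC.StewartYu

end
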